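import Literature.NumberTheory.EllipticCurves.DivisionPointReadings
import Literature.NumberTheory.ComplexMultiplication.EllipticUnits.DeShalitDivisionPointsLatticeGeneral
import HarnessLib

/-!
# Readings of division points at one level: families of readings, and the sixteen-object block of (N1)-PKG
# (`DivisionPointsKernelMembership`) — de Shalit II.1.5 (15), II.1.10, II.4.4 (iv) (proofs only)

Topic `NumberTheory/EllipticCurves` (theorems only; no definition, no named fact, no instance, no `sorry`).  Cell `bsd-print-cf2`,
width seat `bsd-line-cf2c-w4` g16, piece (RD) «READINGS», sequel of `DivisionPointReadings` (one reading `exists_reading`, the model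
lattice memberships, the B10f-b block).  Here:

* `exists_reading_family` — for any index type `I`, a predicate `ok`, points `Z i ∈ 𝔠ᵢ⁻¹L ∖ L` with `𝔑·v^{n+1} ≤ 𝔣ψ·𝔠ᵢ` on `ok`:
  functions `x y : I → K̄`, `X Y : I → E·K_π^{n+1}` reading `ξ(Z i)` wherever `ok i` (junk elsewhere);
* `mem_idealInvLattice_mul_span_of_sub_mem` (`ι(d)·z − Ω·ι(c) ∈ L` ⇒ `z ∈ (𝔪·(d))⁻¹L`) and the three memberships
  `translate_mem_idealInvLattice`, `base_add_translate_mem_idealInvLattice`, `gen_mul_base_add_translate_mem_idealInvLattice`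
  (`k·u_{N+1} + ub`, `Ω + (…)`, `ι(π₀)(Ω + (…)) ∈ (𝔪·(π₀^{N+1}π₁))⁻¹L` for any `ub` with `ι(π₁)ub ∈ L` — the `𝔭̄`-translates of
  `DeShalitDivisionPointsLatticeGeneral`);
* ★★★ `exists_divisionPt_readings_at_level` — THE SIXTEEN-OBJECT BLOCK of
  `DivisionPointsKernelMembership.some_mem_kernel_divisionPt_of_readings` (families `Y`: `ξ(u_{N+1})`, `S`: `ξ(k·u_{N+1} + ub)`,
  `W`: `ξ(Ω + (k·u_{N+1} + ub))`, `Z`: `ξ(αc(Ω + (k·u_{N+1} + ub)))`, `αc = ι(π₀)`, `ub` any `𝔭̄`-division point: `ι(π₁)ub ∈ L`, `ub ∉ L`; equations for `N ≤ m`, all `k`) at one level `m`,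
  in that theorem's binder shapes with `Kb := K̄`, `ιc := ι̂`, `ιv := e`, `ι₀ := ι`, `𝔣 := 𝔪`, `M := E·K_π^{m+1}`; reading modulus
  `𝔑 ≤ 𝔣ψ·𝔪·(π₁)` (the translates are `𝔪𝔭^{N+1}𝔭̄`-division points, coordinates in `K(𝔣ψ·𝔪·𝔭^{N+1}·𝔭̄)`).

No summit statement is proved; BSD is not proved by any of this.

## References
* [deShalit1987] E. de Shalit, *Iwasawa theory of elliptic curves with complex multiplication* (1987), II §1.5 (15) (p. 42),
  II §1.10 Lemma (p. 39), II §4.4 (iv) (p. 57–58), II §4.9 (23) (p. 62–63).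
* [SilvermanAEC2009] J. H. Silverman, *The Arithmetic of Elliptic Curves*, 2nd ed. (2009), III.1, VI.3.6 (b).
-/

noncomputable section

open scoped Classical NumberField
open NumberField IsDedekindDomain IsDedekindDomain.HeightOneSpectrum Field PeriodPair
open Literature.NumberTheory.NumberFields Literature.NumberTheory.GaloisRepresentations
  Literature.NumberTheory.GaloisRepresentations.IsNonarchimedeanLocalField Literature.NumberTheory.GaloisRepresentations.LubinTate
  Literature.NumberTheory.ComplexMultiplication.EllipticUnits

namespace Literature.NumberTheory.EllipticCurves

namespace DivisionPointReadings

variable {K : Type} [Field K] [NumberField K] (ι : K →+* ℂ) (L : PeriodPair) (W : WeierstrassCurve ℤ) {𝔣ψ : Ideal (𝓞 K)}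
  [IsTotallyComplex K] {v : HeightOneSpectrum (𝓞 K)} {𝔑 𝔪 : Ideal (𝓞 K)} {Ω : ℂ} {π₀ β : 𝓞 K}

/-! ## §1 Families of readings -/

open ValuativeRel in
/-- ★★ **A family of readings with junk outside a predicate**: for `Z : I → ℂ` with `Z i ∈ 𝔠ᵢ⁻¹L ∖ L` and `𝔑·v^{n+1} ≤ 𝔣ψ·𝔠ᵢ`
whenever `ok i`, there are `x y : I → K̄`, `X Y : I → E·K_π^{n+1}` reading `ξ(Z i)` for every `i` with `ok i` (values at the other
indices are unspecified). [cite: deShalit1987, II §1.5 (15), II §1.10, II §4.4 (iv)] -/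
theorem exists_reading_family
    (h6 : ∀ 𝔠 : Ideal (𝓞 K), 𝔠 ≠ ⊥ → ∀ z : ℂ, z ∈ idealInvLattice ι 𝔠 L.lattice → z ∉ L.lattice →
      ∃ x y : rayClassField K (𝔣ψ * 𝔠), algClosureEmb ι x = ℘[L] z ∧ algClosureEmb ι y = ℘'[L] z)
    {I : Type*} (ok : I → Prop) (Z : I → ℂ) (𝔠 : I → Ideal (𝓞 K)) (h𝔠 : ∀ i, ok i → 𝔠 i ≠ ⊥)
    (hz : ∀ i, ok i → Z i ∈ idealInvLattice ι (𝔠 i) L.lattice) (hzL : ∀ i, ok i → Z i ∉ L.lattice)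
    (h𝔑 : 𝔑 ≠ ⊥) (hv : ¬ 𝔑 ≤ v.asIdeal)
    {π : 𝒪[v.adicCompletion K]} (hπ : (valuation (v.adicCompletion K)).IsUniformizer (π : v.adicCompletion K))
    {α : 𝓞 K} (hα0 : α ≠ 0) (hα𝔑 : α - 1 ∈ 𝔑) (hαw : ∀ w : HeightOneSpectrum (𝓞 K), w ≠ v → α ∉ w.asIdeal)
    {f : ℕ} (hαπ : ((α : K) : v.adicCompletion K) = (π : v.adicCompletion K) ^ f)
    (E : IntermediateField (v.adicCompletion K) (AlgebraicClosure (v.adicCompletion K)))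
    [FiniteDimensional (v.adicCompletion K) E] [Normal (v.adicCompletion K) E]
    (hdegE : ∀ w : WeilGroup (v.adicCompletion K),
      WeilGroup.toAbsGalois (v.adicCompletion K) w ∈ E.fixingSubgroup → (f : ℤ) ∣ WeilGroup.deg w)
    (n : ℕ) (hle : ∀ i, ok i → 𝔑 * v.asIdeal ^ (n + 1) ≤ 𝔣ψ * 𝔠 i) :
    ∃ (x y : I → AlgebraicClosure K)
      (X Y : I → ↥(E ⊔ ltField π n : IntermediateField (v.adicCompletion K) (AlgebraicClosure (v.adicCompletion K)))),
      (∀ i, ok i → algClosureEmb ι (x i) = ℘[L] (Z i) - (W.baseChange ℂ).b₂ / 12) ∧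
      (∀ i, ok i → algClosureEmb ι (y i) =
        (℘'[L] (Z i) - (W.baseChange ℂ).a₁ * (℘[L] (Z i) - (W.baseChange ℂ).b₂ / 12) - (W.baseChange ℂ).a₃) / 2) ∧
      (∀ i, ok i → ((X i : ↥(E ⊔ ltField π n : IntermediateField (v.adicCompletion K) (AlgebraicClosure (v.adicCompletion K)))) :
          AlgebraicClosure (v.adicCompletion K)) = (absClosureEmbedding K (v.adicCompletion K)).toRingHom (x i)) ∧
      (∀ i, ok i → ((Y i : ↥(E ⊔ ltField π n : IntermediateField (v.adicCompletion K) (AlgebraicClosure (v.adicCompletion K)))) :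
          AlgebraicClosure (v.adicCompletion K)) = (absClosureEmbedding K (v.adicCompletion K)).toRingHom (y i)) := by
  have R : ∀ i : I, ∃ (x y : AlgebraicClosure K)
      (X Y : ↥(E ⊔ ltField π n : IntermediateField (v.adicCompletion K) (AlgebraicClosure (v.adicCompletion K)))),
      ok i → (algClosureEmb ι x = ℘[L] (Z i) - (W.baseChange ℂ).b₂ / 12 ∧
        algClosureEmb ι y = (℘'[L] (Z i) - (W.baseChange ℂ).a₁ * (℘[L] (Z i) - (W.baseChange ℂ).b₂ / 12) - (W.baseChange ℂ).a₃) / 2 ∧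
        ((X : ↥(E ⊔ ltField π n : IntermediateField (v.adicCompletion K) (AlgebraicClosure (v.adicCompletion K)))) :
          AlgebraicClosure (v.adicCompletion K)) = (absClosureEmbedding K (v.adicCompletion K)).toRingHom x ∧
        ((Y : ↥(E ⊔ ltField π n : IntermediateField (v.adicCompletion K) (AlgebraicClosure (v.adicCompletion K)))) :
          AlgebraicClosure (v.adicCompletion K)) = (absClosureEmbedding K (v.adicCompletion K)).toRingHom y) := by
    intro i
    by_cases hi : ok i
    · obtain ⟨x, y, X, Y, hx, hy, hX, hY⟩ := exists_reading ι L W h6 (h𝔠 i hi) (hz i hi) (hzL i hi) h𝔑 hv hπ hα0 hα𝔑 hαw hαπ E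
        hdegE n (hle i hi)
      exact ⟨x, y, X, Y, fun _ => ⟨hx, hy, hX, hY⟩⟩
    · exact ⟨0, 0, 0, 0, fun h => absurd h hi⟩
  choose x y X Y hR using R
  exact ⟨x, y, X, Y, fun i hi => (hR i hi).1, fun i hi => (hR i hi).2.1, fun i hi => (hR i hi).2.2.1, fun i hi => (hR i hi).2.2.2⟩

omit [NumberField K] [IsTotallyComplex K] in
/-- **`ι(d)·z − Ω·ι(c) ∈ L` with `c ∈ 𝒪_K` ⇒ `z ∈ (𝔪·(d))⁻¹L`** for `L = Ω·ι(𝔪)` (`(𝔪·(d))⁻¹L` is the colon lattice; `L` is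
`𝒪_K`-stable). [cite: deShalit1987, II §4.2 (6), II §4.4] -/
theorem mem_idealInvLattice_mul_span_of_sub_mem (hL : ∀ z : ℂ, z ∈ L.lattice ↔ ∃ a ∈ 𝔪, z = Ω * ι (a : K))
    {z : ℂ} {d c : 𝓞 K} (h : ι (d : K) * z - Ω * ι (c : K) ∈ L.lattice) :
    z ∈ idealInvLattice ι (𝔪 * Ideal.span {d}) L.lattice := by
  rw [mem_idealInvLattice_iff]
  intro a ha
  rw [mul_comm, Ideal.mem_span_singleton_mul] at ha
  obtain ⟨b, hb, rfl⟩ := ha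
  have h1 := isCMLattice_of_model ι hL b _ h
  have h2 : Ω * ι ((b * c : 𝓞 K) : K) ∈ L.lattice := (hL _).mpr ⟨b * c, 𝔪.mul_mem_right _ hb, rfl⟩
  have e : ι (((d * b : 𝓞 K)) : K) * z = ι (b : K) * (ι (d : K) * z - Ω * ι (c : K)) + Ω * ι ((b * c : 𝓞 K) : K) := by
    push_cast
    simp only [map_mul]
    ring
  rw [e]
  exact add_mem h1 h2

variable {ub : ℂ} {π₁ : 𝓞 K}

omit [NumberField K] [IsTotallyComplex K] in
/-- **`k·u_{N+1} + ub ∈ (𝔪·(π₀^{N+1}π₁))⁻¹L`** for any `ub` with `ι(π₁)·ub ∈ L` (a `𝔭̄`-division point):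
`ι(π₀^{N+1}π₁)(k·u_{N+1} + ub) − Ω·ι(kπ₁((βπ₀)^{N+1} − 1)) = ι(π₀^{N+1})·(ι(π₁)ub) ∈ L`. [cite: deShalit1987, II §4.4 (iv)] -/
theorem translate_mem_idealInvLattice (hL : ∀ z : ℂ, z ∈ L.lattice ↔ ∃ a ∈ 𝔪, z = Ω * ι (a : K)) (hπ₀ : π₀ ≠ 0)
    (hub1 : ι (π₁ : K) * ub ∈ L.lattice) (N k : ℕ) :
    (k : ℂ) * (ι ((β ^ (N + 1) : 𝓞 K) : K) * Ω - Ω / ι ((π₀ ^ (N + 1) : 𝓞 K) : K)) + ub ∈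
      idealInvLattice ι (𝔪 * Ideal.span {π₀ ^ (N + 1) * π₁}) L.lattice := by
  refine mem_idealInvLattice_mul_span_of_sub_mem ι L hL (c := (k : 𝓞 K) * π₁ * ((β * π₀) ^ (N + 1) - 1)) ?_
  have e1 := pow_mul_divisionPt_eq ι (Ω := Ω) hπ₀ β (N + 1)
  have key : ι ((π₀ ^ (N + 1) * π₁ : 𝓞 K) : K) * ((k : ℂ) * (ι ((β ^ (N + 1) : 𝓞 K) : K) * Ω - Ω / ι ((π₀ ^ (N + 1) : 𝓞 K) : K)) + ub) -
      Ω * ι ((((k : 𝓞 K) * π₁ * ((β * π₀) ^ (N + 1) - 1) : 𝓞 K)) : K) =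
      ι ((π₀ ^ (N + 1) : 𝓞 K) : K) * (ι (π₁ : K) * ub) := by
    have e2 : ι ((π₀ ^ (N + 1) * π₁ : 𝓞 K) : K) = ι ((π₀ ^ (N + 1) : 𝓞 K) : K) * ι (π₁ : K) := by push_cast; rw [map_mul]
    have e3 : ι ((((k : 𝓞 K) * π₁ * ((β * π₀) ^ (N + 1) - 1) : 𝓞 K)) : K) =
        (k : ℂ) * ι (π₁ : K) * ι ((((β * π₀) ^ (N + 1) - 1 : 𝓞 K)) : K) := by push_cast; rw [map_mul, map_mul, map_natCast]
    rw [e2, e3]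
    linear_combination (k : ℂ) * ι (π₁ : K) * e1
  rw [key]
  exact isCMLattice_of_model ι hL _ _ hub1

omit [NumberField K] [IsTotallyComplex K] in
/-- **`Ω + (k·u_{N+1} + ub) ∈ (𝔪·(π₀^{N+1}π₁))⁻¹L`**. [cite: deShalit1987, II §4.4 (iv)] -/
theorem base_add_translate_mem_idealInvLattice (hL : ∀ z : ℂ, z ∈ L.lattice ↔ ∃ a ∈ 𝔪, z = Ω * ι (a : K)) (hπ₀ : π₀ ≠ 0)
    (hub1 : ι (π₁ : K) * ub ∈ L.lattice) (N k : ℕ) :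
    Ω + ((k : ℂ) * (ι ((β ^ (N + 1) : 𝓞 K) : K) * Ω - Ω / ι ((π₀ ^ (N + 1) : 𝓞 K) : K)) + ub) ∈
      idealInvLattice ι (𝔪 * Ideal.span {π₀ ^ (N + 1) * π₁}) L.lattice := by
  refine mem_idealInvLattice_mul_span_of_sub_mem ι L hL
    (c := π₀ ^ (N + 1) * π₁ + (k : 𝓞 K) * π₁ * ((β * π₀) ^ (N + 1) - 1)) ?_
  have e1 := pow_mul_divisionPt_eq ι (Ω := Ω) hπ₀ β (N + 1)
  have key : ι ((π₀ ^ (N + 1) * π₁ : 𝓞 K) : K) * (Ω + ((k : ℂ) * (ι ((β ^ (N + 1) : 𝓞 K) : K) * Ω - Ω / ι ((π₀ ^ (N + 1) : 𝓞 K) : K)) + ub)) -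
      Ω * ι (((π₀ ^ (N + 1) * π₁ + (k : 𝓞 K) * π₁ * ((β * π₀) ^ (N + 1) - 1) : 𝓞 K)) : K) =
      ι ((π₀ ^ (N + 1) : 𝓞 K) : K) * (ι (π₁ : K) * ub) := by
    have e2 : ι ((π₀ ^ (N + 1) * π₁ : 𝓞 K) : K) = ι ((π₀ ^ (N + 1) : 𝓞 K) : K) * ι (π₁ : K) := by push_cast; rw [map_mul]
    have e3 : ι (((π₀ ^ (N + 1) * π₁ + (k : 𝓞 K) * π₁ * ((β * π₀) ^ (N + 1) - 1) : 𝓞 K)) : K) =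
        ι ((π₀ ^ (N + 1) : 𝓞 K) : K) * ι (π₁ : K) + (k : ℂ) * ι (π₁ : K) * ι ((((β * π₀) ^ (N + 1) - 1 : 𝓞 K)) : K) := by
      push_cast; rw [map_add, map_mul, map_mul, map_mul, map_natCast]
    rw [e2, e3]
    linear_combination (k : ℂ) * ι (π₁ : K) * e1
  rw [key]
  exact isCMLattice_of_model ι hL _ _ hub1

omit [NumberField K] [IsTotallyComplex K] in
/-- **`αc·(Ω + (k·u_{N+1} + ub)) ∈ (𝔪·(π₀^{N+1}π₁))⁻¹L`** for `αc = ι(π₀)`. [cite: deShalit1987, II §4.4 (iv)] -/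
theorem gen_mul_base_add_translate_mem_idealInvLattice (hL : ∀ z : ℂ, z ∈ L.lattice ↔ ∃ a ∈ 𝔪, z = Ω * ι (a : K)) (hπ₀ : π₀ ≠ 0)
    (hub1 : ι (π₁ : K) * ub ∈ L.lattice) (N k : ℕ) :
    ι (π₀ : K) * (Ω + ((k : ℂ) * (ι ((β ^ (N + 1) : 𝓞 K) : K) * Ω - Ω / ι ((π₀ ^ (N + 1) : 𝓞 K) : K)) + ub)) ∈
      idealInvLattice ι (𝔪 * Ideal.span {π₀ ^ (N + 1) * π₁}) L.lattice := by
  refine mem_idealInvLattice_mul_span_of_sub_mem ι L hL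
    (c := π₀ * (π₀ ^ (N + 1) * π₁ + (k : 𝓞 K) * π₁ * ((β * π₀) ^ (N + 1) - 1))) ?_
  have e1 := pow_mul_divisionPt_eq ι (Ω := Ω) hπ₀ β (N + 1)
  have key : ι ((π₀ ^ (N + 1) * π₁ : 𝓞 K) : K) * (ι (π₀ : K) *
      (Ω + ((k : ℂ) * (ι ((β ^ (N + 1) : 𝓞 K) : K) * Ω - Ω / ι ((π₀ ^ (N + 1) : 𝓞 K) : K)) + ub))) -
      Ω * ι (((π₀ * (π₀ ^ (N + 1) * π₁ + (k : 𝓞 K) * π₁ * ((β * π₀) ^ (N + 1) - 1)) : 𝓞 K)) : K) =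
      ι (π₀ : K) * (ι ((π₀ ^ (N + 1) : 𝓞 K) : K) * (ι (π₁ : K) * ub)) := by
    have e2 : ι ((π₀ ^ (N + 1) * π₁ : 𝓞 K) : K) = ι ((π₀ ^ (N + 1) : 𝓞 K) : K) * ι (π₁ : K) := by push_cast; rw [map_mul]
    have e3 : ι (((π₀ * (π₀ ^ (N + 1) * π₁ + (k : 𝓞 K) * π₁ * ((β * π₀) ^ (N + 1) - 1)) : 𝓞 K)) : K) =
        ι (π₀ : K) * (ι ((π₀ ^ (N + 1) : 𝓞 K) : K) * ι (π₁ : K) + (k : ℂ) * ι (π₁ : K) * ι ((((β * π₀) ^ (N + 1) - 1 : 𝓞 K)) : K)) := by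
      push_cast; rw [map_mul, map_add, map_mul, map_mul, map_mul, map_natCast]
    rw [e2, e3]
    linear_combination (k : ℂ) * ι (π₁ : K) * ι (π₀ : K) * e1
  rw [key]
  exact isCMLattice_of_model ι hL _ _ (isCMLattice_of_model ι hL _ _ hub1)

open ValuativeRel in
/-- ★★★ **READINGS for (N1)-PKG at one level `m`**: the four reading families of
`DivisionPointsKernelMembership.some_mem_kernel_divisionPt_of_readings` — `Y`: `ξ(u_{N+1})`; `S`: `ξ(k·u_{N+1} + ub)`;
`W`: `ξ(Ω + (k·u_{N+1} + ub))`; `Z`: `ξ(αc·(Ω + (k·u_{N+1} + ub)))` with `αc = ι(π₀)` — as functions `ℕ → K̄` / `ℕ → ℕ → K̄` and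
`ℕ → M` / `ℕ → ℕ → M`, `M = E·K_π^{m+1}`, with the sixteen reading equations for `N ≤ m` (all `k`), EXACTLY in that theorem's binder
shapes (`Kb := K̄`, `ιc := ι̂`, `ιv := e`, `ι₀ := ι`, `𝔣 := 𝔪`).  The division points of level `N + 1 ≤ m + 1` and the
`𝔭̄`-translates have coordinates in `K(𝔣ψ·𝔪·𝔭^{N+1}·𝔭̄)`, read into `E·K_π^{m+1}` for a reading modulus `𝔑 ≤ 𝔣ψ·𝔪·(π₁)`.
[cite: deShalit1987, II §1.5 (15), II §1.10, II §4.4 (iv)] -/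
theorem exists_divisionPt_readings_at_level
    (h6 : ∀ 𝔠 : Ideal (𝓞 K), 𝔠 ≠ ⊥ → ∀ z : ℂ, z ∈ idealInvLattice ι 𝔠 L.lattice → z ∉ L.lattice →
      ∃ x y : rayClassField K (𝔣ψ * 𝔠), algClosureEmb ι x = ℘[L] z ∧ algClosureEmb ι y = ℘'[L] z)
    (hL : ∀ z : ℂ, z ∈ L.lattice ↔ ∃ a ∈ 𝔪, z = Ω * ι (a : K)) (hΩ : Ω ≠ 0)
    (hv0 : v.asIdeal = Ideal.span {π₀}) (htr : π₀ + π₁ = 1) (hβ : β * π₀ - 1 ∈ 𝔪)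
    (h2K : (2 : 𝓞 K) = π₀ * π₁) (hp0 : Prime π₀) (hndvd : ¬ π₀ ∣ π₁) (h𝔪2 : ∀ k : ℕ, ((2 : 𝓞 K) ^ k : 𝓞 K) ∉ 𝔪)
    -- a `𝔭̄`-division point `ub` (`ι(π₁)ub ∈ L`, `ub ∉ L`) and the CM multiplier `αc = ι(π₀)`
    (hub1 : ι (π₁ : K) * ub ∈ L.lattice) (hub0 : ub ∉ L.lattice) {αc : ℂ} (hαc : αc = ι (π₀ : K))
    -- the reading modulus and the local frame
    (h𝔑 : 𝔑 ≠ ⊥) (hv : ¬ 𝔑 ≤ v.asIdeal) (h𝔑ψ : 𝔑 ≤ 𝔣ψ * (𝔪 * Ideal.span {π₁}))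
    {π : 𝒪[v.adicCompletion K]} (hπ : (valuation (v.adicCompletion K)).IsUniformizer (π : v.adicCompletion K))
    {α : 𝓞 K} (hα0 : α ≠ 0) (hα𝔑 : α - 1 ∈ 𝔑) (hαw : ∀ w : HeightOneSpectrum (𝓞 K), w ≠ v → α ∉ w.asIdeal)
    {f : ℕ} (hαπ : ((α : K) : v.adicCompletion K) = (π : v.adicCompletion K) ^ f)
    (E : IntermediateField (v.adicCompletion K) (AlgebraicClosure (v.adicCompletion K)))
    [FiniteDimensional (v.adicCompletion K) E] [Normal (v.adicCompletion K) E]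
    (hdegE : ∀ w : WeilGroup (v.adicCompletion K),
      WeilGroup.toAbsGalois (v.adicCompletion K) w ∈ E.fixingSubgroup → (f : ℤ) ∣ WeilGroup.deg w)
    (m : ℕ) :
    ∃ (xY yY : ℕ → AlgebraicClosure K)
      (XY YY : ℕ → ↥(E ⊔ ltField π m : IntermediateField (v.adicCompletion K) (AlgebraicClosure (v.adicCompletion K))))
      (xS yS : ℕ → ℕ → AlgebraicClosure K)
      (XS YS : ℕ → ℕ → ↥(E ⊔ ltField π m : IntermediateField (v.adicCompletion K) (AlgebraicClosure (v.adicCompletion K))))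
      (xW yW : ℕ → ℕ → AlgebraicClosure K)
      (XW YW : ℕ → ℕ → ↥(E ⊔ ltField π m : IntermediateField (v.adicCompletion K) (AlgebraicClosure (v.adicCompletion K))))
      (xZ yZ : ℕ → ℕ → AlgebraicClosure K)
      (XZ YZ : ℕ → ℕ → ↥(E ⊔ ltField π m : IntermediateField (v.adicCompletion K) (AlgebraicClosure (v.adicCompletion K)))),
      -- `Y`: `ξ(u_{N+1})`
      (∀ N ≤ m, algClosureEmb ι (xY N) =
        ℘[L] ((ι ((β ^ (N + 1) : 𝓞 K) : K) * Ω - Ω / ι ((π₀ ^ (N + 1) : 𝓞 K) : K))) - (W.baseChange ℂ).b₂ / 12) ∧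
      (∀ N ≤ m, algClosureEmb ι (yY N) = (℘'[L] ((ι ((β ^ (N + 1) : 𝓞 K) : K) * Ω - Ω / ι ((π₀ ^ (N + 1) : 𝓞 K) : K))) -
        (W.baseChange ℂ).a₁ * (℘[L] ((ι ((β ^ (N + 1) : 𝓞 K) : K) * Ω - Ω / ι ((π₀ ^ (N + 1) : 𝓞 K) : K))) - (W.baseChange ℂ).b₂ / 12) -
        (W.baseChange ℂ).a₃) / 2) ∧
      (∀ N ≤ m, ((XY N : ↥(E ⊔ ltField π m : IntermediateField (v.adicCompletion K) (AlgebraicClosure (v.adicCompletion K)))) :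
          AlgebraicClosure (v.adicCompletion K)) = (absClosureEmbedding K (v.adicCompletion K)).toRingHom (xY N)) ∧
      (∀ N ≤ m, ((YY N : ↥(E ⊔ ltField π m : IntermediateField (v.adicCompletion K) (AlgebraicClosure (v.adicCompletion K)))) :
          AlgebraicClosure (v.adicCompletion K)) = (absClosureEmbedding K (v.adicCompletion K)).toRingHom (yY N)) ∧
      -- `S`: `ξ(k·u_{N+1} + ub)`
      (∀ N ≤ m, ∀ k : ℕ, algClosureEmb ι (xS N k) = ℘[L] ((k : ℂ) * (ι ((β ^ (N + 1) : 𝓞 K) : K) * Ω - Ω / ι ((π₀ ^ (N + 1) : 𝓞 K) : K)) +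
        ub) - (W.baseChange ℂ).b₂ / 12) ∧
      (∀ N ≤ m, ∀ k : ℕ, algClosureEmb ι (yS N k) = (℘'[L] ((k : ℂ) * (ι ((β ^ (N + 1) : 𝓞 K) : K) * Ω - Ω / ι ((π₀ ^ (N + 1) : 𝓞 K) : K)) +
        ub) - (W.baseChange ℂ).a₁ * (℘[L] ((k : ℂ) * (ι ((β ^ (N + 1) : 𝓞 K) : K) * Ω -
          Ω / ι ((π₀ ^ (N + 1) : 𝓞 K) : K)) + ub) - (W.baseChange ℂ).b₂ / 12) - (W.baseChange ℂ).a₃) / 2) ∧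
      (∀ N ≤ m, ∀ k : ℕ, ((XS N k : ↥(E ⊔ ltField π m : IntermediateField (v.adicCompletion K) (AlgebraicClosure (v.adicCompletion K)))) :
          AlgebraicClosure (v.adicCompletion K)) = (absClosureEmbedding K (v.adicCompletion K)).toRingHom (xS N k)) ∧
      (∀ N ≤ m, ∀ k : ℕ, ((YS N k : ↥(E ⊔ ltField π m : IntermediateField (v.adicCompletion K) (AlgebraicClosure (v.adicCompletion K)))) :
          AlgebraicClosure (v.adicCompletion K)) = (absClosureEmbedding K (v.adicCompletion K)).toRingHom (yS N k)) ∧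
      -- `W`: `ξ(Ω + (k·u_{N+1} + ub))`
      (∀ N ≤ m, ∀ k : ℕ, algClosureEmb ι (xW N k) = ℘[L] (Ω + ((k : ℂ) * (ι ((β ^ (N + 1) : 𝓞 K) : K) * Ω - Ω / ι ((π₀ ^ (N + 1) : 𝓞 K) : K)) +
        ub)) - (W.baseChange ℂ).b₂ / 12) ∧
      (∀ N ≤ m, ∀ k : ℕ, algClosureEmb ι (yW N k) = (℘'[L] (Ω + ((k : ℂ) * (ι ((β ^ (N + 1) : 𝓞 K) : K) * Ω - Ω / ι ((π₀ ^ (N + 1) : 𝓞 K) : K)) +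
        ub)) - (W.baseChange ℂ).a₁ * (℘[L] (Ω + ((k : ℂ) * (ι ((β ^ (N + 1) : 𝓞 K) : K) * Ω -
          Ω / ι ((π₀ ^ (N + 1) : 𝓞 K) : K)) + ub)) - (W.baseChange ℂ).b₂ / 12) - (W.baseChange ℂ).a₃) / 2) ∧
      (∀ N ≤ m, ∀ k : ℕ, ((XW N k : ↥(E ⊔ ltField π m : IntermediateField (v.adicCompletion K) (AlgebraicClosure (v.adicCompletion K)))) :
          AlgebraicClosure (v.adicCompletion K)) = (absClosureEmbedding K (v.adicCompletion K)).toRingHom (xW N k)) ∧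
      (∀ N ≤ m, ∀ k : ℕ, ((YW N k : ↥(E ⊔ ltField π m : IntermediateField (v.adicCompletion K) (AlgebraicClosure (v.adicCompletion K)))) :
          AlgebraicClosure (v.adicCompletion K)) = (absClosureEmbedding K (v.adicCompletion K)).toRingHom (yW N k)) ∧
      -- `Z`: `ξ(αc·(Ω + (k·u_{N+1} + ub)))`
      (∀ N ≤ m, ∀ k : ℕ, algClosureEmb ι (xZ N k) = ℘[L] (αc * (Ω + ((k : ℂ) * (ι ((β ^ (N + 1) : 𝓞 K) : K) * Ω -
        Ω / ι ((π₀ ^ (N + 1) : 𝓞 K) : K)) + ub))) - (W.baseChange ℂ).b₂ / 12) ∧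
      (∀ N ≤ m, ∀ k : ℕ, algClosureEmb ι (yZ N k) = (℘'[L] (αc * (Ω + ((k : ℂ) * (ι ((β ^ (N + 1) : 𝓞 K) : K) * Ω -
        Ω / ι ((π₀ ^ (N + 1) : 𝓞 K) : K)) + ub))) - (W.baseChange ℂ).a₁ * (℘[L] (αc * (Ω + ((k : ℂ) *
          (ι ((β ^ (N + 1) : 𝓞 K) : K) * Ω - Ω / ι ((π₀ ^ (N + 1) : 𝓞 K) : K)) + ub))) -
            (W.baseChange ℂ).b₂ / 12) - (W.baseChange ℂ).a₃) / 2) ∧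
      (∀ N ≤ m, ∀ k : ℕ, ((XZ N k : ↥(E ⊔ ltField π m : IntermediateField (v.adicCompletion K) (AlgebraicClosure (v.adicCompletion K)))) :
          AlgebraicClosure (v.adicCompletion K)) = (absClosureEmbedding K (v.adicCompletion K)).toRingHom (xZ N k)) ∧
      (∀ N ≤ m, ∀ k : ℕ, ((YZ N k : ↥(E ⊔ ltField π m : IntermediateField (v.adicCompletion K) (AlgebraicClosure (v.adicCompletion K)))) :
          AlgebraicClosure (v.adicCompletion K)) = (absClosureEmbedding K (v.adicCompletion K)).toRingHom (yZ N k)) := by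
  subst hαc
  have hπ₀ : π₀ ≠ 0 := hp0.ne_zero
  have hπ₁0 : π₁ ≠ 0 := by
    rintro rfl
    apply h𝔪2 1
    rw [pow_one, h2K, mul_zero]
    exact 𝔪.zero_mem
  have h𝔪0 : 𝔪 ≠ ⊥ := by
    rintro rfl
    obtain ⟨a, ha, h⟩ := (hL _).mp L.ω₁_mem_lattice
    rw [Ideal.mem_bot] at ha
    rw [ha] at h
    simp only [map_zero, mul_zero] at h
    exact L.ω₁_div_two_notMem_lattice (by rw [h, zero_div]; exact L.lattice.zero_mem)
  -- the common division ideal `𝔠_N := 𝔪·(π₀^{N+1}π₁)` and the bound `𝔑·v^{m+1} ≤ 𝔣ψ·𝔠_N` for `N ≤ m`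
  have hne : ∀ N : ℕ, 𝔪 * Ideal.span {π₀ ^ (N + 1) * π₁} ≠ ⊥ := fun N =>
    mul_ne_zero h𝔪0 (show Ideal.span {π₀ ^ (N + 1) * π₁} ≠ ⊥ from
      fun h => mul_ne_zero (pow_ne_zero _ hπ₀) hπ₁0 (Ideal.span_singleton_eq_bot.mp h))
  have hle : ∀ N : ℕ, N ≤ m → 𝔑 * v.asIdeal ^ (m + 1) ≤ 𝔣ψ * (𝔪 * Ideal.span {π₀ ^ (N + 1) * π₁}) := by
    intro N hN
    calc 𝔑 * v.asIdeal ^ (m + 1) ≤ 𝔣ψ * (𝔪 * Ideal.span {π₁}) * v.asIdeal ^ (m + 1) := Ideal.mul_mono_left h𝔑ψ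
      _ = 𝔣ψ * (𝔪 * Ideal.span {π₀ ^ (m + 1) * π₁}) := by
          rw [hv0, Ideal.span_singleton_pow, mul_assoc, mul_assoc, Ideal.span_singleton_mul_span_singleton, mul_comm π₁]
      _ ≤ 𝔣ψ * (𝔪 * Ideal.span {π₀ ^ (N + 1) * π₁}) :=
          Ideal.mul_mono_right (Ideal.mul_mono_right (Ideal.span_singleton_le_span_singleton.mpr
            (mul_dvd_mul_right (pow_dvd_pow π₀ (by omega)) π₁)))
  -- `Y`
  obtain ⟨xY, yY, XY, YY, hxY, hyY, hXY, hYY⟩ := exists_reading_family ι L W h6 (fun N : ℕ => N ≤ m)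
    (fun N => ι ((β ^ (N + 1) : 𝓞 K) : K) * Ω - Ω / ι ((π₀ ^ (N + 1) : 𝓞 K) : K))
    (fun N => 𝔪 * Ideal.span {π₀ ^ (N + 1) * π₁}) (fun N _ => hne N)
    (fun N _ => mem_idealInvLattice_mul_span_of_sub_mem ι L hL
      (c := π₁ * ((β * π₀) ^ (N + 1) - 1)) (by
        rw [show ι ((π₀ ^ (N + 1) * π₁ : 𝓞 K) : K) = ι (π₁ : K) * ι ((π₀ ^ (N + 1) : 𝓞 K) : K) by push_cast; rw [map_mul, mul_comm],
          mul_assoc, pow_mul_divisionPt_eq ι hπ₀ β (N + 1), show ι (π₁ : K) * (Ω * ι ((((β * π₀) ^ (N + 1) - 1 : 𝓞 K)) : K)) -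
            Ω * ι ((π₁ * ((β * π₀) ^ (N + 1) - 1) : 𝓞 K) : K) = 0 by push_cast; rw [map_mul]; ring]
        exact L.lattice.zero_mem))
    (fun N _ => divisionPt_succ_notMem ι hL hΩ h2K hp0 hndvd N)
    h𝔑 hv hπ hα0 hα𝔑 hαw hαπ E hdegE m hle
  -- `S`
  obtain ⟨xS, yS, XS, YS, hxS, hyS, hXS, hYS⟩ := exists_reading_family ι L W h6 (fun i : ℕ × ℕ => i.1 ≤ m)
    (fun i => (i.2 : ℂ) * (ι ((β ^ (i.1 + 1) : 𝓞 K) : K) * Ω - Ω / ι ((π₀ ^ (i.1 + 1) : 𝓞 K) : K)) + ub)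
    (fun i => 𝔪 * Ideal.span {π₀ ^ (i.1 + 1) * π₁}) (fun i _ => hne i.1)
    (fun i _ => translate_mem_idealInvLattice ι L (β := β) hL hπ₀ hub1 i.1 i.2)
    (fun i _ => nsmul_divisionPt_add_notMem ι hL htr hβ hπ₀ hub1 hub0)
    h𝔑 hv hπ hα0 hα𝔑 hαw hαπ E hdegE m (fun i hi => hle i.1 hi)
  -- `W`
  obtain ⟨xW, yW, XW, YW, hxW, hyW, hXW, hYW⟩ := exists_reading_family ι L W h6 (fun i : ℕ × ℕ => i.1 ≤ m)
    (fun i => Ω + ((i.2 : ℂ) * (ι ((β ^ (i.1 + 1) : 𝓞 K) : K) * Ω - Ω / ι ((π₀ ^ (i.1 + 1) : 𝓞 K) : K)) +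
      ub))
    (fun i => 𝔪 * Ideal.span {π₀ ^ (i.1 + 1) * π₁}) (fun i _ => hne i.1)
    (fun i _ => base_add_translate_mem_idealInvLattice ι L (β := β) hL hπ₀ hub1 i.1 i.2)
    (fun i _ => base_add_nsmul_divisionPt_add_notMem ι hL hΩ hβ hπ₀ hub1 h2K h𝔪2)
    h𝔑 hv hπ hα0 hα𝔑 hαw hαπ E hdegE m (fun i hi => hle i.1 hi)
  -- `Z`
  obtain ⟨xZ, yZ, XZ, YZ, hxZ, hyZ, hXZ, hYZ⟩ := exists_reading_family ι L W h6 (fun i : ℕ × ℕ => i.1 ≤ m)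
    (fun i => ι (π₀ : K) * (Ω + ((i.2 : ℂ) * (ι ((β ^ (i.1 + 1) : 𝓞 K) : K) * Ω - Ω / ι ((π₀ ^ (i.1 + 1) : 𝓞 K) : K)) +
      ub)))
    (fun i => 𝔪 * Ideal.span {π₀ ^ (i.1 + 1) * π₁}) (fun i _ => hne i.1)
    (fun i _ => gen_mul_base_add_translate_mem_idealInvLattice ι L (β := β) hL hπ₀ hub1 i.1 i.2)
    (fun i _ => mul_base_add_nsmul_divisionPt_add_notMem ι hL hΩ hβ hπ₀ hub1 h2K h𝔪2)
    h𝔑 hv hπ hα0 hα𝔑 hαw hαπ E hdegE m (fun i hi => hle i.1 hi)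
  exact ⟨xY, yY, XY, YY, fun N k => xS (N, k), fun N k => yS (N, k), fun N k => XS (N, k), fun N k => YS (N, k),
    fun N k => xW (N, k), fun N k => yW (N, k), fun N k => XW (N, k), fun N k => YW (N, k),
    fun N k => xZ (N, k), fun N k => yZ (N, k), fun N k => XZ (N, k), fun N k => YZ (N, k),
    hxY, hyY, hXY, hYY,
    fun N hN k => hxS (N, k) hN, fun N hN k => hyS (N, k) hN, fun N hN k => hXS (N, k) hN, fun N hN k => hYS (N, k) hN,
    fun N hN k => hxW (N, k) hN, fun N hN k => hyW (N, k) hN, fun N hN k => hXW (N, k) hN, fun N hN k => hYW (N, k) hN,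
    fun N hN k => hxZ (N, k) hN, fun N hN k => hyZ (N, k) hN, fun N hN k => hXZ (N, k) hN, fun N hN k => hYZ (N, k) hN⟩

end DivisionPointReadings

end Literature.NumberTheory.EllipticCurves

end
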